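import Literature.NumberTheory.Automorphic.CompactOpenAveraging
import Literature.NumberTheory.Automorphic.JacquetModule
import HarnessLib

/-!
# The Hecke ray operator `T_a = e_K ∘ π(a)` on `V^K` for an Iwahori-factorised `K` — powers, matrix coefficients,
# compatibility with the Jacquet module, nilpotence on `V^K ∩ V(N)` (Casselman 1995, §3.3–§4.1, rank-one kit)

Topic `NumberTheory/Automorphic`; namespace `Representation` (next to ★ `Representation.avgProj`, ★ `Representation.jacquetModule`).
THEOREMS + ONE DEFINITION WITH BODY (`Representation.heckeRay ρ K a v := e_K (ρ a v)`); no named fact, no instance, no `sorry`.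
Cell `hodgecm-mathlib`, F0∕P3, seat F0P3-p01 (g10): file (R1) of the rank-one road to Casselman's square-integrability criterion
★ `UnitaryGroup.U3SquareIntegrableExponents` [Casselman1995, Thm. 4.4.6] that avoids the canonical pairing.

SETTING.  `G` a topological group, `ρ` a SMOOTH representation of `G` on a `k`-vector space (`char k = 0`), `t = (P, M, N)` a parabolic
triple with `N` closed, `K ≤ G` a compact open subgroup with an Iwahori factorisation `K = (K ∩ N̄)(K ∩ M)(K ∩ N)` (as sets, for some
subgroup `N̄`, exactly the shape of ★ `ParabolicTriple.IwahoriDatum.factorization`), and `a ∈ M` with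
`a (K ∩ N) a⁻¹ ⊆ K`, `a⁻¹ (K ∩ N̄) a ⊆ K ∩ N̄`, `a` commuting with `K ∩ M` («`a` dominant»).  `e_K` is the finite-sum averaging projector ★
`Representation.avgProj` (`CompactOpenAveraging`).

RESULTS.
* §1 `avgProj_eq_avgProj_inf_N` — Casselman's «Jacquet's first lemma» [Casselman1995, Thm. 3.3.4: `P_{K₀} v = P_{N₀} v` for
  `v ∈ V^{M₀N₀⁻}`] COMBINATORIALLY: a left transversal of `K ∩ N` modulo the stabiliser is one of `K` (no Haar measure).
* §2 `heckeRay ρ K a` (`T_a v = e_K (ρ a v)`): maps `V^K` to `V^K`; `heckeRay_apply_avgProj_apply` (`e_K π(a) e_K π(b) v = e_K π(ab) v` on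
  `V^K` for dominant `b`); **`heckeRay_iterate` (`T_a^m v = e_K π(a^m) v`)** — the Hecke-algebra identity `[KaK]^m = [Ka^mK]` on `V^K`
  [Casselman1995, §4.1; BernsteinZelevinsky1976, §3.15].
* §3 `apply_pow_eq_apply_heckeRay_iterate` — **matrix coefficients along the ray: `φ(π(a^m) v) = φ(T_a^m v)`** for a `K`-invariant linear form `φ`
  and `v ∈ V^K` [Casselman1995, §4.1].
* §4 `mk_heckeRay` — **`[T_a v] = π_N(a)[v]` in the Jacquet module `V_N`** (★ `jacquetModule_mk`) [Casselman1995, Prop. 4.1.4].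
* §5 `exists_heckeRay_iterate_eq_zero` — **nilpotence on `V^K ∩ V(N)`**: if `[v] = 0` and every `n ∈ N` is conjugated into `K` by some
  `a^m` (`⋃ₘ a⁻ᵐ (K ∩ N) aᵐ = N`), then `T_a^m v = 0` for `m ≫ 0` [Casselman1995, Prop. 4.1.6; BernsteinZelevinsky1976, 3.17] — the
  mechanism of ★ `JacquetCuspidalCompactCoefficients` for `V(N) = V`.
The Fitting decomposition `V^K = ker T_a^∞ ⊕ im T_a^∞ ≅ ? ⊕ V_N^{K ∩ M}` (with ★ Jacquet's lemma `fixedPoints_jacquetModule_le_map`) is the sequel (R2).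

## References
* [Casselman1995] W. Casselman, *Introduction to the theory of admissible representations of `p`-adic reductive groups* (draft 1 May 1995),
  Prop. 1.4.4, Thm. 3.3.3, Thm. 3.3.4, §4.1 (Prop. 4.1.4, Prop. 4.1.6), Thm. 4.4.6.
* [BernsteinZelevinsky1976] I. N. Bernstein, A. V. Zelevinsky, Russian Math. Surveys 31:3 (1976), §2.3 (`e_K`), §3.15–3.19.
* [Bump1997] D. Bump, *Automorphic forms and representations*, Prop. 4.4.1.
-/

set_option autoImplicit false

open scoped BigOperators Pointwise
open Literature.NumberTheory.Automorphic

namespace Representation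

section HeckeRay

variable {k G V : Type*} [Field k] [CharZero k] [Group G] [TopologicalSpace G] [IsTopologicalGroup G]
  [AddCommGroup V] [Module k V] {ρ : Representation k G V}

/-! ## §0 Two small facts on the averaging projector -/

/-- A `K`-invariant linear form sees through `e_K`: `φ (e_K v) = φ v` for smooth `v`. [cite: Casselman1995, §2.1] -/
theorem apply_avgProj_eq_of_forall {K : Subgroup G} (hK : IsCompact (K : Set G)) (φ : V →ₗ[k] k)
    (hφ : ∀ κ ∈ K, ∀ x : V, φ (ρ κ x) = φ x) {v : V} (hv : ρ.IsSmoothVector v) : φ (ρ.avgProj K v) = φ v := by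
  classical
  obtain ⟨R, hR⟩ := exists_isLeftTransversal hK hv
  rw [avgProj_eq hK hv (fun t ht => (ρ.mem_stabilizerSubgroup v t).1 ht) hR, map_smul, map_sum]
  have hsum : ∑ r ∈ R, φ (ρ r v) = ∑ r ∈ R, φ v :=
    Finset.sum_congr rfl fun r hr => hφ r (hR.mem_of_mem r hr) v
  rw [hsum, Finset.sum_const, nsmul_eq_mul, smul_eq_mul, ← mul_assoc,
    inv_mul_cancel₀ (Nat.cast_ne_zero.2 (Finset.card_pos.2 hR.nonempty).ne'), one_mul]

/-- `e_K (ρ κ x - x) = 0` for `κ ∈ K` and smooth `x`. [cite: BernsteinZelevinsky1976, §2.3] -/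
theorem avgProj_apply_sub_self_eq_zero {K : Subgroup G} (hK : IsCompact (K : Set G)) (hρ : ρ.IsSmooth) {κ : G} (hκ : κ ∈ K)
    (x : V) : ρ.avgProj K (ρ κ x - x) = 0 := by
  rw [sub_eq_add_neg, avgProj_add hK (hρ _) (hρ _), avgProj_apply_of_mem hK (hρ x) hκ, ← neg_one_smul k x,
    avgProj_smul hK _ (hρ x), neg_one_smul, add_neg_cancel]

/-! ## §1 Jacquet's first lemma, combinatorially: `e_K w = e_{K ∩ N} w` for `w ∈ V^{(K ∩ N̄)(K ∩ M)}` -/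

/-- `e_K 0 = 0`. [cite: BernsteinZelevinsky1976, §2.3] -/
theorem avgProj_zero_of_isSmooth {K : Subgroup G} (hK : IsCompact (K : Set G)) (hρ : ρ.IsSmooth) : ρ.avgProj K (0 : V) = 0 := by
  have h := avgProj_smul hK (0 : k) (hρ (0 : V))
  rwa [zero_smul, zero_smul] at h

/-- `e_K` pushed through a finite sum of smooth vectors. [cite: BernsteinZelevinsky1976, §2.3] -/
theorem avgProj_sum_of_isSmooth {K : Subgroup G} (hK : IsCompact (K : Set G)) (hρ : ρ.IsSmooth) {ι : Type*} (s : Finset ι)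
    (f : ι → V) : ρ.avgProj K (∑ i ∈ s, f i) = ∑ i ∈ s, ρ.avgProj K (f i) := by
  change ρ.avgProjLinear K hρ hK (∑ i ∈ s, f i) = ∑ i ∈ s, ρ.avgProjLinear K hρ hK (f i)
  exact map_sum _ _ _

/-! ## §1 Jacquet's first lemma, combinatorially: `e_K w = e_{K ∩ N} w` for `w ∈ V^{(K ∩ N̄)(K ∩ M)}` -/

omit [CharZero k] [TopologicalSpace G] [IsTopologicalGroup G] in
/-- **A transversal of `K ∩ N` modulo the stabiliser is a transversal of `K`** when `K = (K ∩ N̄)(K ∩ M)(K ∩ N)` and `w` is fixed by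
`K ∩ N̄` and `K ∩ M`: every `κ ∈ K` is `n m n̄` with `m n̄` in the stabiliser. [cite: Casselman1995, Thm. 3.3.4 p. 35] -/
theorem isLeftTransversal_of_factorization {K Nbar M N : Subgroup G}
    (hfac : (K : Set G) = ((K ⊓ Nbar : Subgroup G) : Set G) * ((K ⊓ M : Subgroup G) : Set G) * ((K ⊓ N : Subgroup G) : Set G))
    {w : V} (hwM : ∀ m ∈ K ⊓ M, ρ m w = w) (hwNbar : ∀ nb ∈ K ⊓ Nbar, ρ nb w = w) {R : Finset G}
    (hR : IsLeftTransversal (K ⊓ N) ((K ⊓ N) ⊓ ρ.stabilizerSubgroup w) R) :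
    IsLeftTransversal K (K ⊓ ρ.stabilizerSubgroup w) R := by
  refine ⟨fun r hr => (Subgroup.mem_inf.1 (hR.mem_of_mem r hr)).1, fun x hx => ?_⟩
  -- factor `x⁻¹ = n̄ m n`, so `x = n⁻¹ m⁻¹ n̄⁻¹`
  have hx' : x⁻¹ ∈ ((K : Subgroup G) : Set G) := K.inv_mem hx
  rw [hfac] at hx'
  obtain ⟨nm, hnm, n, hn, hprod⟩ := Set.mem_mul.1 hx'
  obtain ⟨nb, hnb, m, hm, rfl⟩ := Set.mem_mul.1 hnm
  have hnb' : nb ∈ K ⊓ Nbar := hnb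
  have hm' : m ∈ K ⊓ M := hm
  have hn' : n ∈ K ⊓ N := hn
  have hxeq : x = n⁻¹ * (m⁻¹ * nb⁻¹) := by rw [← inv_inv x, ← hprod, mul_inv_rev, mul_inv_rev]
  -- `m⁻¹ n̄⁻¹` stabilises `w`
  have hstab : m⁻¹ * nb⁻¹ ∈ ρ.stabilizerSubgroup w := by
    rw [mem_stabilizerSubgroup, map_mul, Module.End.mul_apply, hwNbar _ ((K ⊓ Nbar).inv_mem hnb'),
      hwM _ ((K ⊓ M).inv_mem hm')]
  obtain ⟨r, ⟨hrR, hr⟩, huniq⟩ := hR.existsUnique n⁻¹ ((K ⊓ N).inv_mem hn')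
  have hrK : r ∈ K := (Subgroup.mem_inf.1 (hR.mem_of_mem r hrR)).1
  refine ⟨r, ⟨hrR, Subgroup.mem_inf.2 ⟨K.mul_mem (K.inv_mem hrK) hx, ?_⟩⟩, fun r' hr' => huniq r' ⟨hr'.1, ?_⟩⟩
  · -- `r⁻¹ x = (r⁻¹ n⁻¹)(m⁻¹ n̄⁻¹) ∈ Stab(w)`
    have h1 : r⁻¹ * n⁻¹ ∈ ρ.stabilizerSubgroup w := (Subgroup.mem_inf.1 hr).2
    have : r⁻¹ * x = (r⁻¹ * n⁻¹) * (m⁻¹ * nb⁻¹) := by rw [hxeq]; group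
    rw [this]
    exact (ρ.stabilizerSubgroup w).mul_mem h1 hstab
  · -- uniqueness: `r'⁻¹ n⁻¹ = (r'⁻¹ x)(m⁻¹ n̄⁻¹)⁻¹`
    have hr'x : r'⁻¹ * x ∈ ρ.stabilizerSubgroup w := (Subgroup.mem_inf.1 hr'.2).2
    have hmem : r'⁻¹ * n⁻¹ ∈ ρ.stabilizerSubgroup w := by
      have : r'⁻¹ * n⁻¹ = (r'⁻¹ * x) * (m⁻¹ * nb⁻¹)⁻¹ := by rw [hxeq]; group
      rw [this]
      exact (ρ.stabilizerSubgroup w).mul_mem hr'x ((ρ.stabilizerSubgroup w).inv_mem hstab)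
    exact Subgroup.mem_inf.2
      ⟨(K ⊓ N).mul_mem ((K ⊓ N).inv_mem (hR.mem_of_mem r' hr'.1)) ((K ⊓ N).inv_mem hn'), hmem⟩

omit [IsTopologicalGroup G] in
/-- The intersection of a compact subgroup with a closed one is compact. [folklore] -/
private theorem isCompact_inf_of_isClosed {K N : Subgroup G} (hK : IsCompact (K : Set G)) (hN : IsClosed (N : Set G)) :
    IsCompact ((K ⊓ N : Subgroup G) : Set G) := by
  rw [Subgroup.coe_inf]
  exact hK.inter_right hN

/-- **Jacquet's first lemma (Casselman's Thm. 3.3.4), finite-sum form: `e_K w = e_{K ∩ N} w`** for `w` smooth and fixed by `K ∩ N̄` and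
`K ∩ M`, when `K = (K ∩ N̄)(K ∩ M)(K ∩ N)` (`K` compact, `N` closed). [cite: Casselman1995, Thm. 3.3.4 p. 35] [cite: BernsteinZelevinsky1976, §3.16] -/
theorem avgProj_eq_avgProj_inf_N {K Nbar M N : Subgroup G} (hK : IsCompact (K : Set G)) (hN : IsClosed (N : Set G))
    (hfac : (K : Set G) = ((K ⊓ Nbar : Subgroup G) : Set G) * ((K ⊓ M : Subgroup G) : Set G) * ((K ⊓ N : Subgroup G) : Set G))
    {w : V} (hw : ρ.IsSmoothVector w) (hwM : ∀ m ∈ K ⊓ M, ρ m w = w) (hwNbar : ∀ nb ∈ K ⊓ Nbar, ρ nb w = w) :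
    ρ.avgProj K w = ρ.avgProj (K ⊓ N) w := by
  classical
  have hKN := isCompact_inf_of_isClosed hK hN
  obtain ⟨R, hR⟩ := exists_isLeftTransversal hKN hw
  have hstab : ∀ s ∈ ρ.stabilizerSubgroup w, ρ s w = w := fun s hs => (ρ.mem_stabilizerSubgroup w s).1 hs
  rw [avgProj_eq hKN hw hstab hR, avgProj_eq hK hw hstab (isLeftTransversal_of_factorization hfac hwM hwNbar hR)]

/-- **`[e_S x] = [x]` in the Jacquet module for `S ≤ N` compact**: averaging over `N`-elements does not change the class in `V_N`.
[cite: Casselman1995, §3.1] [cite: BernsteinZelevinsky1976, §2.3] -/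
theorem mk_avgProj_of_le_N (t : ParabolicTriple G) {S : Subgroup G} (hS : IsCompact (S : Set G)) (hSN : S ≤ t.N) {x : V}
    (hx : ρ.IsSmoothVector x) :
    Coinvariants.mk (t.restrict ρ) (ρ.avgProj S x) = Coinvariants.mk (t.restrict ρ) x := by
  classical
  obtain ⟨R, hR⟩ := exists_isLeftTransversal hS hx
  have hstab : ∀ s ∈ ρ.stabilizerSubgroup x, ρ s x = x := fun s hs => (ρ.mem_stabilizerSubgroup x s).1 hs
  rw [avgProj_eq hS hx hstab hR, map_smul, map_sum]
  have hsum : ∑ r ∈ R, Coinvariants.mk (t.restrict ρ) (ρ r x) = ∑ r ∈ R, Coinvariants.mk (t.restrict ρ) x :=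
    Finset.sum_congr rfl fun r hr => by
      have hrN : r ∈ t.N := hSN (hR.mem_of_mem r hr)
      exact Coinvariants.mk_self_apply (t.restrict ρ) ⟨⟨r, t.N_le hrN⟩, Subgroup.mem_subgroupOf.2 hrN⟩ x
  rw [hsum, Finset.sum_const, ← Nat.cast_smul_eq_nsmul k, smul_smul,
    inv_mul_cancel₀ (Nat.cast_ne_zero.2 (Finset.card_pos.2 hR.nonempty).ne'), one_smul]

/-! ## §2 The Hecke ray operator `T_a v = e_K (ρ a v)` and its powers -/

variable (ρ) in
/-- **The Hecke ray operator** `T_a v := e_K (ρ a v)` (the double-coset operator `[K a K]` up to the volume factor `[K : K ∩ aKa⁻¹]`, acting on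
all of `V`; it is meant on `V^K`). [cite: Casselman1995, §4.1] [cite: BernsteinZelevinsky1976, §3.15] -/
noncomputable def heckeRay (K : Subgroup G) (a : G) (v : V) : V :=
  ρ.avgProj K (ρ a v)

omit [CharZero k] in
/-- Unfolding of `heckeRay`. [cite: Casselman1995, §4.1] -/
theorem heckeRay_apply (K : Subgroup G) (a : G) (v : V) : ρ.heckeRay K a v = ρ.avgProj K (ρ a v) := rfl

/-- `T_a v ∈ V^K` (for smooth `ρ`). [cite: Casselman1995, §4.1] -/
theorem heckeRay_mem_fixedPoints {K : Subgroup G} (hK : IsCompact (K : Set G)) (hρ : ρ.IsSmooth) (a : G) (v : V) :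
    ρ.heckeRay K a v ∈ ρ.fixedPoints K :=
  (ρ.mem_fixedPoints K _).2 fun _ hκ => apply_avgProj hK (hρ _) hκ

/-- The iterates `T_a^m v` of a `K`-fixed vector lie in `V^K`. [cite: Casselman1995, §4.1] -/
theorem heckeRay_iterate_mem_fixedPoints {K : Subgroup G} (hK : IsCompact (K : Set G)) (hρ : ρ.IsSmooth) (a : G) {v : V}
    (hv : v ∈ ρ.fixedPoints K) (m : ℕ) : (ρ.heckeRay K a)^[m] v ∈ ρ.fixedPoints K := by
  induction m with
  | zero => exact hv
  | succ m ih => rw [Function.iterate_succ_apply']; exact heckeRay_mem_fixedPoints hK hρ a _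

/-- `T_a` is additive on smooth vectors. [cite: BernsteinZelevinsky1976, §2.3] -/
theorem heckeRay_add {K : Subgroup G} (hK : IsCompact (K : Set G)) (hρ : ρ.IsSmooth) (a : G) (v w : V) :
    ρ.heckeRay K a (v + w) = ρ.heckeRay K a v + ρ.heckeRay K a w := by
  rw [heckeRay_apply, map_add, avgProj_add hK (hρ _) (hρ _), heckeRay_apply, heckeRay_apply]

/-- `T_a` is homogeneous on smooth vectors. [cite: BernsteinZelevinsky1976, §2.3] -/
theorem heckeRay_smul {K : Subgroup G} (hK : IsCompact (K : Set G)) (hρ : ρ.IsSmooth) (a : G) (c : k) (v : V) :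
    ρ.heckeRay K a (c • v) = c • ρ.heckeRay K a v := by
  rw [heckeRay_apply, map_smul, avgProj_smul hK c (hρ _), heckeRay_apply]

/-- `T_a 0 = 0`. [cite: BernsteinZelevinsky1976, §2.3] -/
theorem heckeRay_zero {K : Subgroup G} (hK : IsCompact (K : Set G)) (hρ : ρ.IsSmooth) (a : G) : ρ.heckeRay K a (0 : V) = 0 := by
  rw [heckeRay_apply, map_zero, avgProj_zero_of_isSmooth hK hρ]

/-- The iterates of `T_a` are additive on smooth vectors. [cite: BernsteinZelevinsky1976, §2.3] -/
theorem heckeRay_iterate_add {K : Subgroup G} (hK : IsCompact (K : Set G)) (hρ : ρ.IsSmooth) (a : G) (m : ℕ) (v w : V) :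
    (ρ.heckeRay K a)^[m] (v + w) = (ρ.heckeRay K a)^[m] v + (ρ.heckeRay K a)^[m] w := by
  induction m with
  | zero => rfl
  | succ m ih => simp only [Function.iterate_succ_apply', ih, heckeRay_add hK hρ]

/-- The iterates of `T_a` are homogeneous on smooth vectors. [cite: BernsteinZelevinsky1976, §2.3] -/
theorem heckeRay_iterate_smul {K : Subgroup G} (hK : IsCompact (K : Set G)) (hρ : ρ.IsSmooth) (a : G) (m : ℕ) (c : k) (v : V) :
    (ρ.heckeRay K a)^[m] (c • v) = c • (ρ.heckeRay K a)^[m] v := by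
  induction m with
  | zero => rfl
  | succ m ih => simp only [Function.iterate_succ_apply', ih, heckeRay_smul hK hρ]

/-- The iterates of `T_a` kill `0`. [cite: BernsteinZelevinsky1976, §2.3] -/
theorem heckeRay_iterate_zero {K : Subgroup G} (hK : IsCompact (K : Set G)) (hρ : ρ.IsSmooth) (a : G) (m : ℕ) :
    (ρ.heckeRay K a)^[m] (0 : V) = 0 := by
  induction m with
  | zero => rfl
  | succ m ih => rw [Function.iterate_succ_apply', ih, heckeRay_zero hK hρ]

/-- The iterates of `T_a`, pushed through a finite sum of smooth vectors. [cite: BernsteinZelevinsky1976, §2.3] -/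
theorem heckeRay_iterate_sum {K : Subgroup G} (hK : IsCompact (K : Set G)) (hρ : ρ.IsSmooth) (a : G) (m : ℕ) {ι : Type*}
    (s : Finset ι) (f : ι → V) : (ρ.heckeRay K a)^[m] (∑ i ∈ s, f i) = ∑ i ∈ s, (ρ.heckeRay K a)^[m] (f i) := by
  classical
  induction s using Finset.induction_on with
  | empty => simp only [Finset.sum_empty, heckeRay_iterate_zero hK hρ]
  | insert i s hi ih => rw [Finset.sum_insert hi, Finset.sum_insert hi, heckeRay_iterate_add hK hρ, ih]

omit [TopologicalSpace G] [IsTopologicalGroup G] in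
/-- **Dominance is inherited by powers (Levi part)**: if `a` commutes with `K ∩ M` then so does `a ^ j`. [cite: Casselman1995, Prop. 1.4.3] -/
theorem forall_mul_pow_eq_of_forall_mul_eq {K M : Subgroup G} {a : G} (haM : ∀ m ∈ K ⊓ M, m * a = a * m) (j : ℕ) :
    ∀ m ∈ K ⊓ M, m * a ^ j = a ^ j * m :=
  fun m hm => (Commute.pow_right (haM m hm) j).eq

omit [TopologicalSpace G] [IsTopologicalGroup G] in
/-- **Dominance is inherited by powers (opposite radical)**: `a⁻ʲ (K ∩ N̄) aʲ ⊆ K ∩ N̄`. [cite: Casselman1995, Prop. 1.4.3] -/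
theorem forall_pow_inv_mul_mul_pow_mem {K Nbar : Subgroup G} {a : G} (haNbar : ∀ nb ∈ K ⊓ Nbar, a⁻¹ * nb * a ∈ K ⊓ Nbar) (j : ℕ) :
    ∀ nb ∈ K ⊓ Nbar, (a ^ j)⁻¹ * nb * a ^ j ∈ K ⊓ Nbar := by
  induction j with
  | zero => intro nb hnb; simpa using hnb
  | succ j ih =>
    intro nb hnb
    have h := haNbar _ (ih nb hnb)
    have heq : a⁻¹ * ((a ^ j)⁻¹ * nb * a ^ j) * a = (a ^ (j + 1))⁻¹ * nb * a ^ (j + 1) := by rw [pow_succ]; group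
    rwa [heq] at h

omit [CharZero k] [TopologicalSpace G] [IsTopologicalGroup G] in
/-- **`ρ(b) v` is fixed by `K ∩ M` and `K ∩ N̄`** for `v ∈ V^K` and `b` «dominant»: `b⁻¹ (K ∩ N̄) b ⊆ K` and `b` commutes with `K ∩ M`.
[cite: Casselman1995, Prop. 1.4.3, §4.1] -/
theorem apply_apply_eq_of_dominant {K Nbar M : Subgroup G} {b : G} (hbM : ∀ m ∈ K ⊓ M, m * b = b * m)
    (hbNbar : ∀ nb ∈ K ⊓ Nbar, b⁻¹ * nb * b ∈ K) {v : V} (hv : v ∈ ρ.fixedPoints K) :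
    (∀ m ∈ K ⊓ M, ρ m (ρ b v) = ρ b v) ∧ (∀ nb ∈ K ⊓ Nbar, ρ nb (ρ b v) = ρ b v) := by
  rw [mem_fixedPoints] at hv
  refine ⟨fun m hm => ?_, fun nb hnb => ?_⟩
  · rw [← Module.End.mul_apply, ← map_mul, hbM m hm, map_mul, Module.End.mul_apply, hv m (Subgroup.mem_inf.1 hm).1]
  · have hmul : nb * b = b * (b⁻¹ * nb * b) := by group
    rw [← Module.End.mul_apply, ← map_mul, hmul, map_mul, Module.End.mul_apply, hv _ (hbNbar nb hnb)]

/-- **The key step `e_K π(a) e_K π(b) v = e_K π(ab) v`** for `v ∈ V^K`, `a (K ∩ N) a⁻¹ ⊆ K`, and `b` dominant (`b⁻¹ (K ∩ N̄) b ⊆ K`, `b`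
commuting with `K ∩ M`): by §1, `e_K π(b) v = |R|⁻¹ ∑_{r ∈ R ⊆ K ∩ N} π(r b) v`, and `π(a) π(r b) v = π(a r a⁻¹) π(ab) v` with
`a r a⁻¹ ∈ K` is averaged away by `e_K`. [cite: Casselman1995, §4.1] [cite: BernsteinZelevinsky1976, §3.15] -/
theorem avgProj_apply_avgProj_apply {K Nbar M N : Subgroup G} (hK : IsCompact (K : Set G)) (hN : IsClosed (N : Set G))
    (hρ : ρ.IsSmooth)
    (hfac : (K : Set G) = ((K ⊓ Nbar : Subgroup G) : Set G) * ((K ⊓ M : Subgroup G) : Set G) * ((K ⊓ N : Subgroup G) : Set G))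
    {a b : G} (haN : ∀ n ∈ K ⊓ N, a * n * a⁻¹ ∈ K) (hbM : ∀ m ∈ K ⊓ M, m * b = b * m)
    (hbNbar : ∀ nb ∈ K ⊓ Nbar, b⁻¹ * nb * b ∈ K) {v : V} (hv : v ∈ ρ.fixedPoints K) :
    ρ.avgProj K (ρ a (ρ.avgProj K (ρ b v))) = ρ.avgProj K (ρ (a * b) v) := by
  classical
  obtain ⟨hwM, hwNbar⟩ := apply_apply_eq_of_dominant (ρ := ρ) hbM hbNbar hv
  have hKN := isCompact_inf_of_isClosed hK hN
  have hw : ρ.IsSmoothVector (ρ b v) := hρ _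
  obtain ⟨R, hR⟩ := exists_isLeftTransversal hKN hw
  have hstab : ∀ s ∈ ρ.stabilizerSubgroup (ρ b v), ρ s (ρ b v) = ρ b v :=
    fun s hs => (ρ.mem_stabilizerSubgroup _ s).1 hs
  have hterm : ∀ r ∈ R, ρ.avgProj K (ρ a (ρ r (ρ b v))) = ρ.avgProj K (ρ (a * b) v) := by
    intro r hr
    have hmul : a * r * b = (a * r * a⁻¹) * (a * b) := by group
    rw [← Module.End.mul_apply, ← map_mul, ← Module.End.mul_apply, ← map_mul, hmul, map_mul, Module.End.mul_apply,
      avgProj_apply_of_mem hK (hρ _) (haN r (hR.mem_of_mem r hr))]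
  rw [avgProj_eq_avgProj_inf_N hK hN hfac hw hwM hwNbar, avgProj_eq hKN hw hstab hR, map_smul, map_sum,
    avgProj_smul hK _ (hρ _), avgProj_sum_of_isSmooth hK hρ, Finset.sum_congr rfl hterm, Finset.sum_const,
    ← Nat.cast_smul_eq_nsmul k, smul_smul, inv_mul_cancel₀ (Nat.cast_ne_zero.2 (Finset.card_pos.2 hR.nonempty).ne'), one_smul]

/-- **`T_a^{m+1} v = e_K π(a^{m+1}) v` on `V^K`** — the Hecke-algebra identity `[KaK]^{m+1} ∝ [Ka^{m+1}K]` for a dominant `a`: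
`a (K ∩ N) a⁻¹ ⊆ K`, `a⁻¹ (K ∩ N̄) a ⊆ K ∩ N̄`, `a` commuting with `K ∩ M`. [cite: Casselman1995, §4.1] [cite: BernsteinZelevinsky1976, §3.15] -/
theorem heckeRay_iterate_succ {K Nbar M N : Subgroup G} (hK : IsCompact (K : Set G)) (hN : IsClosed (N : Set G)) (hρ : ρ.IsSmooth)
    (hfac : (K : Set G) = ((K ⊓ Nbar : Subgroup G) : Set G) * ((K ⊓ M : Subgroup G) : Set G) * ((K ⊓ N : Subgroup G) : Set G))
    {a : G} (haM : ∀ m ∈ K ⊓ M, m * a = a * m) (haN : ∀ n ∈ K ⊓ N, a * n * a⁻¹ ∈ K)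
    (haNbar : ∀ nb ∈ K ⊓ Nbar, a⁻¹ * nb * a ∈ K ⊓ Nbar) {v : V} (hv : v ∈ ρ.fixedPoints K) (m : ℕ) :
    (ρ.heckeRay K a)^[m + 1] v = ρ.avgProj K (ρ (a ^ (m + 1)) v) := by
  induction m with
  | zero => rw [zero_add, Function.iterate_one, pow_one, heckeRay_apply]
  | succ m ih =>
    rw [Function.iterate_succ_apply', ih, heckeRay_apply,
      avgProj_apply_avgProj_apply hK hN hρ hfac haN (forall_mul_pow_eq_of_forall_mul_eq haM (m + 1))
        (fun nb hnb => (Subgroup.mem_inf.1 (forall_pow_inv_mul_mul_pow_mem haNbar (m + 1) nb hnb)).1) hv,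
      ← pow_succ']

/-- **`T_a^m v = e_K π(a^m) v` on `V^K`** (all `m`; `K` open so that `e_K v = v`). [cite: Casselman1995, §4.1] [cite: BernsteinZelevinsky1976, §3.15] -/
theorem heckeRay_iterate_eq {K Nbar M N : Subgroup G} (hK : IsCompact (K : Set G)) (hKo : IsOpen (K : Set G))
    (hN : IsClosed (N : Set G)) (hρ : ρ.IsSmooth)
    (hfac : (K : Set G) = ((K ⊓ Nbar : Subgroup G) : Set G) * ((K ⊓ M : Subgroup G) : Set G) * ((K ⊓ N : Subgroup G) : Set G))
    {a : G} (haM : ∀ m ∈ K ⊓ M, m * a = a * m) (haN : ∀ n ∈ K ⊓ N, a * n * a⁻¹ ∈ K)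
    (haNbar : ∀ nb ∈ K ⊓ Nbar, a⁻¹ * nb * a ∈ K ⊓ Nbar) {v : V} (hv : v ∈ ρ.fixedPoints K) (m : ℕ) :
    (ρ.heckeRay K a)^[m] v = ρ.avgProj K (ρ (a ^ m) v) := by
  cases m with
  | zero =>
    rw [Function.iterate_zero, id, pow_zero, map_one, Module.End.one_apply,
      avgProj_of_forall_apply_eq hK hKo ((ρ.mem_fixedPoints K v).1 hv)]
  | succ m => exact heckeRay_iterate_succ hK hN hρ hfac haM haN haNbar hv m

/-! ## §3 Matrix coefficients along the ray -/

/-- **`φ(π(a^m) v) = φ(T_a^m v)`** for a `K`-invariant linear form `φ` and `v ∈ V^K`: the matrix coefficient `m ↦ ⟨φ, π(a^m) v⟩` is read on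
the finite-dimensional space `V^K` through the iterates of ONE operator. [cite: Casselman1995, §4.1, Thm. 4.3.3] -/
theorem apply_pow_apply_eq_apply_heckeRay_iterate {K Nbar M N : Subgroup G} (hK : IsCompact (K : Set G)) (hKo : IsOpen (K : Set G))
    (hN : IsClosed (N : Set G)) (hρ : ρ.IsSmooth)
    (hfac : (K : Set G) = ((K ⊓ Nbar : Subgroup G) : Set G) * ((K ⊓ M : Subgroup G) : Set G) * ((K ⊓ N : Subgroup G) : Set G))
    {a : G} (haM : ∀ m ∈ K ⊓ M, m * a = a * m) (haN : ∀ n ∈ K ⊓ N, a * n * a⁻¹ ∈ K)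
    (haNbar : ∀ nb ∈ K ⊓ Nbar, a⁻¹ * nb * a ∈ K ⊓ Nbar) (φ : V →ₗ[k] k) (hφ : ∀ κ ∈ K, ∀ x : V, φ (ρ κ x) = φ x)
    {v : V} (hv : v ∈ ρ.fixedPoints K) (m : ℕ) :
    φ (ρ (a ^ m) v) = φ ((ρ.heckeRay K a)^[m] v) := by
  rw [heckeRay_iterate_eq hK hKo hN hρ hfac haM haN haNbar hv m, apply_avgProj_eq_of_forall hK φ hφ (hρ _)]

/-! ## §4 Compatibility with the Jacquet module -/

/-- **`[T_a v] = π_N(a)[v]` in `V_N`** for `v ∈ V^K` and `a ∈ M` dominant: `e_K π(a) v = e_{K ∩ N} π(a) v` (§1) and averaging over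
`K ∩ N` does not move the class. [cite: Casselman1995, Prop. 4.1.4] [cite: BernsteinZelevinsky1976, §3.17] -/
theorem mk_heckeRay (t : ParabolicTriple G) {K Nbar : Subgroup G} (hK : IsCompact (K : Set G)) (hN : IsClosed (t.N : Set G))
    (hρ : ρ.IsSmooth)
    (hfac : (K : Set G) = ((K ⊓ Nbar : Subgroup G) : Set G) * ((K ⊓ t.M : Subgroup G) : Set G) * ((K ⊓ t.N : Subgroup G) : Set G))
    {a : G} (haMem : a ∈ t.M) (haM : ∀ m ∈ K ⊓ t.M, m * a = a * m) (haNbar : ∀ nb ∈ K ⊓ Nbar, a⁻¹ * nb * a ∈ K) {v : V}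
    (hv : v ∈ ρ.fixedPoints K) :
    Coinvariants.mk (t.restrict ρ) (ρ.heckeRay K a v) = ρ.jacquetModule t ⟨a, haMem⟩ (Coinvariants.mk (t.restrict ρ) v) := by
  obtain ⟨hwM, hwNbar⟩ := apply_apply_eq_of_dominant (ρ := ρ) haM haNbar hv
  rw [heckeRay_apply, avgProj_eq_avgProj_inf_N hK hN hfac (hρ _) hwM hwNbar,
    mk_avgProj_of_le_N t (isCompact_inf_of_isClosed hK hN) inf_le_right (hρ _), jacquetModule_mk]

/-- **`[T_a^m v] = [π(a^m) v] = π_N(a^m)[v]`** for `v ∈ V^K`. [cite: Casselman1995, Prop. 4.1.4] -/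
theorem mk_heckeRay_iterate (t : ParabolicTriple G) {K Nbar : Subgroup G} (hK : IsCompact (K : Set G)) (hKo : IsOpen (K : Set G))
    (hN : IsClosed (t.N : Set G)) (hρ : ρ.IsSmooth)
    (hfac : (K : Set G) = ((K ⊓ Nbar : Subgroup G) : Set G) * ((K ⊓ t.M : Subgroup G) : Set G) * ((K ⊓ t.N : Subgroup G) : Set G))
    {a : G} (haMem : a ∈ t.M) (haM : ∀ m ∈ K ⊓ t.M, m * a = a * m) (haN : ∀ n ∈ K ⊓ t.N, a * n * a⁻¹ ∈ K)
    (haNbar : ∀ nb ∈ K ⊓ Nbar, a⁻¹ * nb * a ∈ K ⊓ Nbar) {v : V} (hv : v ∈ ρ.fixedPoints K) (m : ℕ) :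
    Coinvariants.mk (t.restrict ρ) ((ρ.heckeRay K a)^[m] v) =
      ρ.jacquetModule t (⟨a, haMem⟩ ^ m) (Coinvariants.mk (t.restrict ρ) v) := by
  obtain ⟨hwM, hwNbar⟩ := apply_apply_eq_of_dominant (ρ := ρ) (forall_mul_pow_eq_of_forall_mul_eq haM m)
    (fun nb hnb => (Subgroup.mem_inf.1 (forall_pow_inv_mul_mul_pow_mem haNbar m nb hnb)).1) hv
  rw [heckeRay_iterate_eq hK hKo hN hρ hfac haM haN haNbar hv m, avgProj_eq_avgProj_inf_N hK hN hfac (hρ _) hwM hwNbar,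
    mk_avgProj_of_le_N t (isCompact_inf_of_isClosed hK hN) inf_le_right (hρ _), jacquetModule_mk]
  rfl

/-! ## §5 Nilpotence on `V^K ∩ V(N)` -/

/-- **`e_K π(a^m) x = 0` for `m ≫ 0` and every `x ∈ V(N)`**, provided each `n ∈ N` is conjugated into `K` by all large powers of `a`
(`⋃ₘ a⁻ᵐ (K ∩ N) aᵐ = N`): on a generator `π(n) y − y`, `π(a^m)(π(n)y − y) = π(a^m n a^{-m}) z − z` with `a^m n a^{-m} ∈ K`.
[cite: Casselman1995, Prop. 4.1.6] [cite: BernsteinZelevinsky1976, 3.17] -/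
theorem exists_forall_avgProj_apply_pow_eq_zero (t : ParabolicTriple G) {K : Subgroup G} (hK : IsCompact (K : Set G))
    (hρ : ρ.IsSmooth) {a : G} (hexh : ∀ n ∈ t.N, ∃ m : ℕ, ∀ m', m ≤ m' → a ^ m' * n * (a ^ m')⁻¹ ∈ K) {x : V}
    (hx : x ∈ Coinvariants.ker (t.restrict ρ)) :
    ∃ m : ℕ, ∀ m', m ≤ m' → ρ.avgProj K (ρ (a ^ m') x) = 0 := by
  unfold Coinvariants.ker at hx
  induction hx using Submodule.span_induction with
  | mem x hx =>
    obtain ⟨⟨n, y⟩, rfl⟩ := hx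
    obtain ⟨m, hm⟩ := hexh ((n : ↥t.P) : G) (Subgroup.mem_subgroupOf.1 n.2)
    refine ⟨m, fun m' hm' => ?_⟩
    have hmul : a ^ m' * ((n : ↥t.P) : G) = (a ^ m' * ((n : ↥t.P) : G) * (a ^ m')⁻¹) * a ^ m' := by group
    show ρ.avgProj K (ρ (a ^ m') (ρ ((n : ↥t.P) : G) y - y)) = 0
    rw [map_sub, ← Module.End.mul_apply, ← map_mul, hmul, map_mul, Module.End.mul_apply]
    exact avgProj_apply_sub_self_eq_zero hK hρ (hm m' hm') _
  | zero => exact ⟨0, fun m' _ => by rw [map_zero, avgProj_zero_of_isSmooth hK hρ]⟩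
  | add x y _ _ ihx ihy =>
    obtain ⟨mx, hx⟩ := ihx
    obtain ⟨my, hy⟩ := ihy
    exact ⟨max mx my, fun m' hm' => by
      rw [map_add, avgProj_add hK (hρ _) (hρ _), hx m' (le_of_max_le_left hm'), hy m' (le_of_max_le_right hm'), add_zero]⟩
  | smul c x _ ih =>
    obtain ⟨m, hm⟩ := ih
    exact ⟨m, fun m' hm' => by rw [map_smul, avgProj_smul hK c (hρ _), hm m' hm', smul_zero]⟩

/-- **Nilpotence of `T_a` on `V^K ∩ V(N)`**: if `v ∈ V^K` has class `[v] = 0` in `V_N` then `T_a^m v = 0` for all large `m`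
(`a` dominant, `⋃ₘ a⁻ᵐ (K ∩ N) aᵐ = N`). Equivalently: the kernel of `V^K → V_N` is the `T_a`-nilpotent part of `V^K` (the converse
inclusion is §4). [cite: Casselman1995, Prop. 4.1.6] [cite: BernsteinZelevinsky1976, 3.17–3.19] -/
theorem exists_heckeRay_iterate_eq_zero (t : ParabolicTriple G) {K Nbar : Subgroup G} (hK : IsCompact (K : Set G))
    (hKo : IsOpen (K : Set G)) (hN : IsClosed (t.N : Set G)) (hρ : ρ.IsSmooth)
    (hfac : (K : Set G) = ((K ⊓ Nbar : Subgroup G) : Set G) * ((K ⊓ t.M : Subgroup G) : Set G) * ((K ⊓ t.N : Subgroup G) : Set G))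
    {a : G} (haM : ∀ m ∈ K ⊓ t.M, m * a = a * m) (haN : ∀ n ∈ K ⊓ t.N, a * n * a⁻¹ ∈ K)
    (haNbar : ∀ nb ∈ K ⊓ Nbar, a⁻¹ * nb * a ∈ K ⊓ Nbar)
    (hexh : ∀ n ∈ t.N, ∃ m : ℕ, ∀ m', m ≤ m' → a ^ m' * n * (a ^ m')⁻¹ ∈ K)
    {v : V} (hv : v ∈ ρ.fixedPoints K) (h0 : Coinvariants.mk (t.restrict ρ) v = 0) :
    ∃ m : ℕ, ∀ m', m ≤ m' → (ρ.heckeRay K a)^[m'] v = 0 := by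
  obtain ⟨m, hm⟩ := exists_forall_avgProj_apply_pow_eq_zero t hK hρ hexh ((Coinvariants.mk_eq_zero _).1 h0)
  exact ⟨m, fun m' hm' => by rw [heckeRay_iterate_eq hK hKo hN hρ hfac haM haN haNbar hv m', hm m' hm']⟩

end HeckeRay

end Representation
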